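import Literature.Computability.QuantumComplexity.ForrelationDerivativeTables
import Literature.Computability.QuantumComplexity.ForrelationSignTransport

/-!
# `NearExactIsExact` (stmt-QuantumAdvantage-14043), line `direct-sum-amplification` — low-rank dyadic pinning (LP)

Stub `stub_lrdrPin` of the line `direct-sum-amplification` for the crux
`Summit.QuantumAdvantage.QuantumAdvantage.Theses.CubicForrelation.NearExactIsExact`.

**What.** Let `A, B : 𝔽₂ⁿ → {±1}` and fix a direction `u`. Write `T_F(u,v) = ∑_x F(x) F(x ⊕ u) (-1)^{v·x}`
(`DerivativeWalsh.dwt F u v`) for row `u` of the derivative Walsh table of `F`. Suppose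

* row `u` of `T_A` is PLATEAUED: every entry is `0` or has square `4^s`;
* row `u` of `T_B` is DYADIC entrywise: every entry is `0` or has square `4^t` for some `t` (depending on the entry);
* the two rows are uniformly `w`-close, `|T_B(u,v) − T_A(u,v)| ≤ w` for all `v`, with `w < 2^s / 2`.

Then, GIVEN the elementary dyadic pinning fact DP (`x² = 4^s`, `y ∈ {0} ∪ {±2^t}`, `|y − x| < 2^s/2 ⇒ y = x`; it is the
statement of the neighbouring stub `stub_dyadicPin` and enters here as a hypothesis), the two product functions agree
pointwise: `A(x) A(x ⊕ u) = B(x) B(x ⊕ u)` for every `x` (`stub_lrdrPin`). No degree hypotheses are used.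

**Proof.** (1) Pinning on the support: where `T_A(u,v) ≠ 0` the plateau hypothesis gives `T_A(u,v)² = 4^s`, and DP
applied to `x = T_A(u,v)`, `y = T_B(u,v)` gives `T_B(u,v) = T_A(u,v)` (`lrdr_pin_on_support`). (2) Parseval kills `B`
off the support: both rows have mass `∑_v T² = 4ⁿ` (`DerivativeWalsh.sum_dwt_sq_of_sq`); splitting both sums over
`{v : T_A(u,v) = 0}` and its complement (`Finset.sum_filter_add_sum_filter_not`), the complements agree by (1) and
`A`'s part over the zero set vanishes, so `∑_{v : T_A(u,v) = 0} T_B(u,v)² = 0` and every such `T_B(u,v)` is `0` too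
(`lrdr_rows_eq`). (3) Walsh inversion: with `P(x) = A(x)A(x⊕u) − B(x)B(x⊕u)` one has `W_P(v) = T_A(u,v) − T_B(u,v) = 0`
for all `v` (`lrdr_dwt_eq_W`, linearity), so Parseval `∑_v W_P(v)² = 2ⁿ ∑_x P(x)²` (`DerivativeWalsh.sum_W_sq`) forces
`P ≡ 0`.

References (orientation only; everything here is proved): R. O'Donnell, *Analysis of Boolean Functions* (CUP 2014),
§1.4 (Parseval, Walsh inversion); C. Carlet, *Boolean Functions for Cryptography and Coding Theory* (CUP 2021), §6.1
(derivative spectra of bent functions and their duals).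
-/

set_option linter.dupNamespace false -- D-0017: single-problem summit

noncomputable section

namespace Summit.QuantumAdvantage.QuantumAdvantage.Theorems.CubicForrelation.NearExactIsExact

open Finset
open Literature.Computability.QuantumComplexity
open Literature.Computability.QuantumComplexity.BuzetChailloux (bxor)
open Literature.Computability.QuantumComplexity.DerivativeWalsh (dwt W sum_dwt_sq sum_dwt_sq_of_sq sum_W_sq)

/-! ### Step 1: pinning on the support of the plateaued row -/

/-- **Pinning on the support.** Given the dyadic pinning fact DP, if row `u` of `T_A` is plateaued at level `4^s`,
row `u` of `T_B` is dyadic entrywise, and the rows are uniformly `w`-close with `w < 2^s/2`, then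
`T_B(u,v) = T_A(u,v)` at every `v` with `T_A(u,v) ≠ 0`. [folklore] -/
theorem lrdr_pin_on_support
    (hDP : ∀ (x y : ℝ) (s : ℕ), x ^ 2 = (4 : ℝ) ^ s → (y = 0 ∨ ∃ t : ℕ, y ^ 2 = (4 : ℝ) ^ t) →
      |y - x| < (2 : ℝ) ^ s / 2 → y = x)
    {n : ℕ} (A B : (Fin n → Bool) → ℝ) (u : Fin n → Bool) (s : ℕ) (w : ℝ)
    (hplat : ∀ v, dwt A u v = 0 ∨ dwt A u v ^ 2 = (4 : ℝ) ^ s)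
    (hdyad : ∀ v, dwt B u v = 0 ∨ ∃ t : ℕ, dwt B u v ^ 2 = (4 : ℝ) ^ t)
    (hclose : ∀ v, |dwt B u v - dwt A u v| ≤ w) (hw : w < (2 : ℝ) ^ s / 2)
    (v : Fin n → Bool) (hv : dwt A u v ≠ 0) :
    dwt B u v = dwt A u v :=
  hDP (dwt A u v) (dwt B u v) s ((hplat v).resolve_left hv) (hdyad v) (lt_of_le_of_lt (hclose v) hw)

/-! ### Step 2: Parseval kills `B` off the support, so the rows are equal -/

/-- **Equality of the rows.** Under the hypotheses of `lrdr_pin_on_support` and with `A, B` both `±1`-valued, the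
two rows are equal everywhere: both rows have Parseval mass `4ⁿ` (`sum_dwt_sq_of_sq`), they agree on the support of
`A`'s row, so `B`'s row has no mass left off that support. [cite: ODonnell2014, §1.4] -/
theorem lrdr_rows_eq
    (hDP : ∀ (x y : ℝ) (s : ℕ), x ^ 2 = (4 : ℝ) ^ s → (y = 0 ∨ ∃ t : ℕ, y ^ 2 = (4 : ℝ) ^ t) →
      |y - x| < (2 : ℝ) ^ s / 2 → y = x)
    {n : ℕ} (A B : (Fin n → Bool) → ℝ) (u : Fin n → Bool) (s : ℕ) (w : ℝ)
    (hA : ∀ x, A x ^ 2 = 1) (hB : ∀ x, B x ^ 2 = 1)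
    (hplat : ∀ v, dwt A u v = 0 ∨ dwt A u v ^ 2 = (4 : ℝ) ^ s)
    (hdyad : ∀ v, dwt B u v = 0 ∨ ∃ t : ℕ, dwt B u v ^ 2 = (4 : ℝ) ^ t)
    (hclose : ∀ v, |dwt B u v - dwt A u v| ≤ w) (hw : w < (2 : ℝ) ^ s / 2) (v : Fin n → Bool) :
    dwt B u v = dwt A u v := by
  have hsupp : ∀ v, dwt A u v ≠ 0 → dwt B u v = dwt A u v :=
    lrdr_pin_on_support hDP A B u s w hplat hdyad hclose hw
  by_cases hv : dwt A u v = 0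
  swap
  · exact hsupp v hv
  rw [hv]
  -- Parseval for both rows.
  have hPA : ∑ v, dwt A u v ^ 2 = (4 : ℝ) ^ n := sum_dwt_sq_of_sq A hA u
  have hPB : ∑ v, dwt B u v ^ 2 = (4 : ℝ) ^ n := sum_dwt_sq_of_sq B hB u
  -- Split both sums over the zero set of `A`'s row and its complement.
  have splitA := sum_filter_add_sum_filter_not univ (fun v => dwt A u v = 0) (fun v => dwt A u v ^ 2)
  have splitB := sum_filter_add_sum_filter_not univ (fun v => dwt A u v = 0) (fun v => dwt B u v ^ 2)
  have hZA : ∑ v ∈ univ.filter (fun v => dwt A u v = 0), dwt A u v ^ 2 = 0 := by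
    refine sum_eq_zero fun v hv => ?_
    rw [(mem_filter.1 hv).2]
    ring
  have hcompl : ∑ v ∈ univ.filter (fun v => ¬ dwt A u v = 0), dwt B u v ^ 2 =
      ∑ v ∈ univ.filter (fun v => ¬ dwt A u v = 0), dwt A u v ^ 2 := by
    refine sum_congr rfl fun v hv => ?_
    rw [hsupp v (mem_filter.1 hv).2]
  have hZB : ∑ v ∈ univ.filter (fun v => dwt A u v = 0), dwt B u v ^ 2 = 0 := by
    linarith
  have hsq : dwt B u v ^ 2 = 0 :=
    (sum_eq_zero_iff_of_nonneg fun v _ => sq_nonneg (dwt B u v)).1 hZB v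
      (mem_filter.2 ⟨mem_univ _, hv⟩)
  exact (pow_eq_zero_iff (n := 2) (by norm_num)).1 hsq

/-! ### Step 3: Walsh inversion -/

/-- A row of the derivative table is the Walsh transform of the product function:
`T_F(h,v) = W_{x ↦ F(x)F(x⊕h)}(v)` (the two use `(-1)^{v·x}` resp. `(-1)^{x·v}`, equal by `twist_comm`). [folklore] -/
theorem lrdr_dwt_eq_W {n : ℕ} (F : (Fin n → Bool) → ℝ) (h v : Fin n → Bool) :
    dwt F h v = W (fun x => F x * F (bxor x h)) v := by
  unfold dwt W
  exact sum_congr rfl fun x _ => by rw [twist_comm v x]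

/-- **Walsh inversion via Parseval**: a real function all of whose Walsh coefficients vanish is identically zero
(`∑_v W_P(v)² = 2ⁿ ∑_x P(x)²`, `sum_W_sq`). [cite: ODonnell2014, §1.4] -/
theorem lrdr_eq_zero_of_W_eq_zero {n : ℕ} (P : (Fin n → Bool) → ℝ) (hW : ∀ v, W P v = 0)
    (x : Fin n → Bool) : P x = 0 := by
  have hpars : (2 : ℝ) ^ n * ∑ x, P x ^ 2 = 0 := by
    rw [← sum_W_sq P]
    exact sum_eq_zero fun v _ => by rw [hW v]; ring
  have hsum : ∑ x, P x ^ 2 = 0 :=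
    (mul_eq_zero.1 hpars).resolve_left (pow_ne_zero _ two_ne_zero)
  have hsq : P x ^ 2 = 0 :=
    (sum_eq_zero_iff_of_nonneg fun x _ => sq_nonneg (P x)).1 hsum x (mem_univ _)
  exact (pow_eq_zero_iff (n := 2) (by norm_num)).1 hsq

/-- **stub_lrdrPin** (LP; sup-norm pinning + Parseval, from DP). Two `±1`-valued functions `A, B` whose `u`-rows of
derivative tables satisfy: `A`'s row is plateaued (`T_A(u,v) ∈ {0, ±2^s}`), `B`'s row is dyadic entrywise
(`T_B(u,v) ∈ {0} ∪ {±2^t}`), and the rows are uniformly `w`-close with `w < 2^s/2`. Then, given the dyadic pinning fact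
DP (the first antecedent), the rows are EQUAL (DP on the support of `A`'s row; Parseval `Σ_v T² = 4ⁿ` for both rows kills
`B` off that support, `lrdr_rows_eq`), hence so are the functions `x ↦ A(x)A(x⊕u)` and `x ↦ B(x)B(x⊕u)` (Walsh
inversion via `sum_W_sq` applied to the difference, `lrdr_eq_zero_of_W_eq_zero`, using `dwt F u = W (F · F(· ⊕ u))`,
`lrdr_dwt_eq_W`). [cite: ODonnell2014, §1.4] -/
theorem stub_lrdrPin :
    (∀ (x y : ℝ) (s : ℕ), x ^ 2 = (4 : ℝ) ^ s → (y = 0 ∨ ∃ t : ℕ, y ^ 2 = (4 : ℝ) ^ t) →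
      |y - x| < (2 : ℝ) ^ s / 2 → y = x) →
    ∀ (n : ℕ) (A B : (Fin n → Bool) → ℝ) (u : Fin n → Bool) (s : ℕ) (w : ℝ),
      (∀ x, A x ^ 2 = 1) → (∀ x, B x ^ 2 = 1) →
      (∀ v, dwt A u v = 0 ∨ dwt A u v ^ 2 = (4 : ℝ) ^ s) →
      (∀ v, dwt B u v = 0 ∨ ∃ t : ℕ, dwt B u v ^ 2 = (4 : ℝ) ^ t) →
      (∀ v, |dwt B u v - dwt A u v| ≤ w) → w < (2 : ℝ) ^ s / 2 →
      ∀ x, A x * A (bxor x u) = B x * B (bxor x u) := by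
  intro hDP n A B u s w hA hB hplat hdyad hclose hw
  have hrow : ∀ v, dwt B u v = dwt A u v := lrdr_rows_eq hDP A B u s w hA hB hplat hdyad hclose hw
  set P : (Fin n → Bool) → ℝ := fun x => A x * A (bxor x u) - B x * B (bxor x u) with hP
  have hWP : ∀ v, W P v = 0 := by
    intro v
    have e : W P v = dwt A u v - dwt B u v := by
      rw [lrdr_dwt_eq_W, lrdr_dwt_eq_W]
      unfold W
      rw [← sum_sub_distrib]
      exact sum_congr rfl fun x _ => by rw [hP]; ring
    rw [e, hrow v, sub_self]
  intro x
  have hPx : P x = 0 := lrdr_eq_zero_of_W_eq_zero P hWP x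
  rw [hP] at hPx
  exact sub_eq_zero.1 hPx

end Summit.QuantumAdvantage.QuantumAdvantage.Theorems.CubicForrelation.NearExactIsExact

end
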